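/- Copyright: the b2b-balaban cell (near-miss cell 7), T⁴-continuum fan-out, ROUND-2 swarm `t4-ne7b-formalise-*`
(leaf 08, gen 2), row NE7b (node U5c COUNT member).  Released under the licence of the surrounding project. -/
import Summits.QuantumFields.BalabanUV.T4Continuum.Support.HistoryRealiseCells
import Summits.QuantumFields.BalabanUV.T4Continuum.Support.HistoryAssemblyRealiseRun

/-!
# Realised histories: root cells PER RUN (a cutoff-indexed S-profile; typer T-NE7b-7)

Summits-side support leaf of the T⁴-continuum cell (rung (B)+1 on a FINITE torus only; NOT infinite volume, NOT the
mass gap, NOT the Clay statement; NOT a proof of the spine estimate NE7b).  Companion of `Support/HistoryRealiseCells.lean`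
(p211546; row S1b part 5 ∕ typer cut A12-I.2b-cells of `t4/formal/NE7b/DAG.md`), answering the typer's note T-NE7b-7
«PER-RUN S-PROFILE» (journal, 2026-08-20T07:39Z).

WHY.  The current END reads every cutoff `K` with ONE exponent profile `sP : ℕ → ℕ` and the global side conditions
`∀ m, DropCtl sP m`, `sP` stepwise non-increasing — whereas in print the sizes `R_t = L^{s_t}` of the run with cutoff
`K` ((2.5), `B14.IsRj` along the TUNED run `K`) depend on `K`: the print-instantiable reading has a profile PER RUN,
`s K : ℕ → ℕ` (e.g. `s K := HistoryZones.expOf L (R K)`, leaf-07 g2's `HistoryLevelsFlow`), with drop control and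
monotonicity available ONLY UP TO THE CUTOFF (`HistoryZones.dropCtl_expOf : DropCtl (expOf L R) K`,
`expOf_succ_le : ∀ t < K, …`).  Every lemma of `HistoryRealiseCells` is per cutoff with the profile a parameter, except
the packaging; this file re-packages PER RUN and weakens the two flow side conditions to their within-run forms.

WHAT.  §1 within-run arithmetic: `Qfrom_mul_pow_of_le` (`B16SProfile.Qprod_ratio_mul_pow` read from `j`, for
`j + i ≤ K` under `DropCtl s K` only), **`Qfrom_eq_pow_levelOf_sub_of_le`** (from `j` to `j′ ≤ K` one re-blocks by
`L^{levelOf j′ − levelOf j}`, under `DropCtl s K` and «`s` stepwise non-increasing on `[0, K)`» only).  §2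
**`structure RealisedDomainsR (s : ℕ → ℕ → ℕ) …`** = `RealisedDomains` with the profile of the run `K` in every field
(`real : Realises L (s K) (R K) …`, `track`, `disjoint` over `anchorAt L (s K)` ∕ `curDomain L (s K)`, `inBox` at
`levelOf (s K) K`), the defined root-cell map **`cellOfR`** (corner cell at `levelOf (s K) K rootStep`), the constant-
profile junctions `RealisedDomainsR.of_const` ∕ `cellOfR_const`, and THE TWO CELL FIELDS PER RUN:
**`cellOfR_mem_cellN`** (`∈ cellN d n L K (K − rootStep (genT c))`) and **`cellOfR_injOn`**
(`Set.InjOn (cellOfR … K τ) (liveC K τ)`) for `K ≥ K₀`, `τ ∈ T K`, under `0 < L`, `0 < n`, `DropCtl (s K) K` and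
`∀ t < K, s K (t+1) ≤ s K t` — the field shapes of `HistoryAssemblyRealiseLE.RealisedReading.cell_mem ∕ cell_inj`, to
be consumed BY NAME by the per-run END twin (typer (R7-a)∕(R7-b); END owner).  §3 (v2) the JUNCTION with leaf-02 g2's
per-run reading (`HistoryAssemblyRealiseRun`, p211994): **`realisedReadingR_of_domainsR : RealisedDomainsR … →
RealisedReadingR L s (cellN d n L) K₀ R T ped cellP liveC (cellOfR …)`** (within-run side conditions), the run's
profile is stepwise non-increasing FROM THE FLOW (**`runProfile_succ_le`**: monotone couplings ⇐ the sign `b ≥ 0` of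
the β-bounds, `B14FlowStep.g_mono_of_betaNonneg`; then leaf-07 g2's `expOf_succ_le`), and the bridge AT THE RUN'S
PROFILE with NO profile side condition displayed, **`realisedReadingR_of_domainsRun`** (`hdrop` ⇐ leaf-02 g2's
`dropCtl_runProfile`, `hs` ⇐ `runProfile_succ_le`) — the `H` of the R7-b END.  [folklore] finite combinatorics on
OUR carriers; ONE new `structure … : Prop` (hypothesis shape, c1: no `Prop` FACT of print minted); no `[cite:]` tag.

HONEST.  The identification of Bałaban's terms with realised pending pedigrees (H3: reading map, `real`, `track`,
`disjoint`, `inBox`), (B) and the BetaPertH-flow facts stay DISPLAYED; NE7b NOT proved; spine 0∕9.  HONEST DEPENDENCY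
(cell): continuum YM on T⁴ ⇐ BetaPertH ∧ nine spine estimates (0/9 proved); BetaPertH ⇐ (D1) ∧ (D4) ∧ CAP+tail; G-an2-4
gates asym, D1 and NE2/3/4.  This file changes none of it. -/

open Finset
open Literature.MathematicalPhysics.QuantumFieldTheory.Balaban1983to89
open Literature.MathematicalPhysics.QuantumFieldTheory.Balaban1983to89.B13ScaleTransfer
open Literature.MathematicalPhysics.QuantumFieldTheory.Balaban1983to89.B16SProfile
open Literature.MathematicalPhysics.QuantumFieldTheory.Balaban1983to89.B16MergeHorizon
open T4PersistenceDictionary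
open Summit.QuantumFields.BalabanUV.T4Continuum.HistoryTables
open Summit.QuantumFields.BalabanUV.T4Continuum.HistoryGen
open Summit.QuantumFields.BalabanUV.T4Continuum.ZoneTorus
open Summit.QuantumFields.BalabanUV.T4Continuum.HistoryZones
open Summit.QuantumFields.BalabanUV.T4Continuum.HistoryAdmissible
open Summit.QuantumFields.BalabanUV.T4Continuum.HistoryAssemblyRealiseLE
open Summit.QuantumFields.BalabanUV.T4Continuum.HistoryRealise
open Summit.QuantumFields.BalabanUV.T4Continuum.HistoryRealiseCells
open Summit.QuantumFields.BalabanUV.T4Continuum.HistoryFlow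
open Summit.QuantumFields.BalabanUV.T4Continuum.HistoryAssemblyRealiseRun
open T4Continuum

namespace Summit.QuantumFields.BalabanUV.T4Continuum.HistoryRealiseCellsRun

noncomputable section

variable {d : ℕ}

/-! ## §1 Within-run arithmetic: drop control and monotonicity up to the cutoff only -/

section Levels

variable {L : ℕ} {s : ℕ → ℕ} {K : ℕ}

/-- scaling bookkeeping from step `j` WITHIN the run: `Qfrom L s j i · L^{s j} = L^{i + s (j + i)}` for `j + i ≤ K`
under `DropCtl s K` (`B16SProfile.Qprod_ratio_mul_pow` on the shifted window `B16MergeHorizon.dropCtl_shift`).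
[folklore] -/
theorem Qfrom_mul_pow_of_le (L : ℕ) (hdrop : DropCtl s K) {j i : ℕ} (hji : j + i ≤ K) :
    Qfrom L s j i * L ^ s j = L ^ (i + s (j + i)) := by
  have h := Qprod_ratio_mul_pow L (dropCtl_shift hdrop j) i (by omega)
  simpa [Qfrom] using h

/-- within the run the exponent falls by at most one per step: `s j ≤ s j′ + (j′ − j)` for `j ≤ j′ ≤ K` [folklore] -/
theorem windowExp_le_add_sub_of_le (hdrop : DropCtl s K) {j j' : ℕ} (hjj : j ≤ j') (hjK : j' ≤ K) :
    s j ≤ s j' + (j' - j) :=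
  windowExp_le_add (hdrop.mono hjK) (j' - j) j (by omega)

/-- **THE RE-BLOCKING FACTOR BETWEEN TWO STEPS OF THE RUN IS THE LEVEL GAP**: for `j ≤ j′ ≤ K`, exponents stepwise
non-increasing on `[0, K)` and drop-controlled up to `K`, `Qfrom L s j (j′ − j) = L^{levelOf s K j′ − levelOf s K j}`
(`L ≥ 1`). [folklore] -/
theorem Qfrom_eq_pow_levelOf_sub_of_le (hL : 0 < L) (hs : ∀ t, t < K → s (t + 1) ≤ s t) (hdrop : DropCtl s K)
    {j j' : ℕ} (hjj : j ≤ j') (hjK : j' ≤ K) : Qfrom L s j (j' - j) = L ^ (levelOf s K j' - levelOf s K j) := by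
  have h1 : s K ≤ s j' := windowExp_le_of_le hs hjK le_rfl
  have h2 : s j' ≤ s j := windowExp_le_of_le hs hjj hjK
  have h3 : s j ≤ s j' + (j' - j) := windowExp_le_add_sub_of_le hdrop hjj hjK
  have hlv : levelOf s K j' - levelOf s K j = (j' - j) + s j' - s j := by
    rw [levelOf_of_le hjK, levelOf_of_le (hjj.trans hjK)]
    omega
  have hmul := Qfrom_mul_pow_of_le L hdrop (j := j) (i := j' - j) (by omega)
  rw [show j + (j' - j) = j' by omega] at hmul
  have hsplit : L ^ ((j' - j) + s j') = L ^ ((j' - j) + s j' - s j) * L ^ s j := by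
    rw [← pow_add]; congr 1; omega
  rw [hsplit] at hmul
  rw [hlv]
  exact Nat.eq_of_mul_eq_mul_right (pow_pos hL _) hmul

end Levels

/-! ## §2 The displayed reading PER RUN, and the two cell fields per run -/

section Reading

variable {ι α π : Type*} [DecidableEq α]

/-- **THE PER-TERM READING AS REALISED PENDING PEDIGREES WITH THEIR DOMAINS, PER RUN** (typer T-NE7b-7 (R7-a)):
`HistoryRealiseCells.RealisedDomains` with the exponent profile `s K` OF THE RUN with cutoff `K` in every field — for
every `K ≥ K₀`, `τ ∈ T K`: the encoding facts `renew_step`∕`forest`∕`headOldest`; for every live component `c` with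
region history `P := (ped K τ).toPGen (cellP K τ) c` and last-event domain `Z K τ c`: `real` (realised along the run's
blockings `s K` and sizes `R K`, pending at `K`), `track` (the domain contains the re-blocked anchor cube of the
first-born constituent), `disjoint` (distinct live components have disjoint current domains at `K`), `inBox` (the root
anchor lies in the period box of the `n·L^K` torus at the model scale `levelOf (s K) K P.rootStep`).  The
print-instantiable choice is `s K := HistoryZones.expOf L (R K)` ((2.5); (R7-b)). [folklore] -/
structure RealisedDomainsR (L : ℕ) (s : ℕ → ℕ → ℕ) (n K₀ : ℕ) (R : ℕ → ℕ → ℕ) (T : ℕ → Finset ι)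
    (ped : ℕ → ι → Pedigree α π) (cellP : ℕ → ι → π → Pt d × Finset (Pt d)) (liveC : ℕ → ι → Finset α)
    (Z : ℕ → ι → α → Finset (Pt d)) : Prop where
  /-- encoding: a renewal is dated one step after the renewed part -/
  renew_step : ∀ K, K₀ ≤ K → ∀ τ ∈ T K, ∀ c c', Part.old c' true ∈ (ped K τ).parts c →
    (ped K τ).step c' + 1 = (ped K τ).step c
  /-- the pedigree is a forest -/
  forest : ∀ K, K₀ ≤ K → ∀ τ ∈ T K, ∀ c, (ped K τ).Forest c
  /-- oldest line first at every component -/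
  headOldest : ∀ K, K₀ ≤ K → ∀ τ ∈ T K, ∀ c, (ped K τ).HeadOldest c
  /-- every live component is realised by its domain along the run's blockings and pending at the cutoff -/
  real : ∀ K, K₀ ≤ K → ∀ τ ∈ T K, ∀ c ∈ liveC K τ,
    Realises L (s K) (R K) ((ped K τ).toPGen (cellP K τ) c) (Z K τ c) ∧
      PendingAt L (s K) (R K) ((ped K τ).toPGen (cellP K τ) c).lastStep (Z K τ c) K
  /-- the domain contains the re-blocked anchor cube of the first-born constituent -/
  track : ∀ K, K₀ ≤ K → ∀ τ ∈ T K, ∀ c ∈ liveC K τ,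
    anchorAt L (s K) ((ped K τ).toPGen (cellP K τ) c) ((ped K τ).toPGen (cellP K τ) c).lastStep ∈ Z K τ c
  /-- distinct live components of one term have disjoint current domains at the cutoff -/
  disjoint : ∀ K, K₀ ≤ K → ∀ τ ∈ T K, ∀ c ∈ liveC K τ, ∀ c' ∈ liveC K τ, c ≠ c' →
    Disjoint (curDomain L (s K) ((ped K τ).toPGen (cellP K τ) c) (Z K τ c) K)
      (curDomain L (s K) ((ped K τ).toPGen (cellP K τ) c') (Z K τ c') K)
  /-- root anchors lie in the period box at the model scale of their birth step in the run -/
  inBox : ∀ K, K₀ ≤ K → ∀ τ ∈ T K, ∀ c ∈ liveC K τ, ∀ i,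
    0 ≤ rootAnchor ((ped K τ).toPGen (cellP K τ) c) i ∧
      L ^ levelOf (s K) K ((ped K τ).toPGen (cellP K τ) c).rootStep *
        (rootAnchor ((ped K τ).toPGen (cellP K τ) c) i).toNat < n * L ^ K

/-- **THE ROOT CELL PER RUN, DEFINED**: the corner cell of the root anchor at the model scale of the root step in the
run with cutoff `K`. [folklore] -/
def cellOfR (n L : ℕ) (s : ℕ → ℕ → ℕ) (ped : ℕ → ι → Pedigree α π) (cellP : ℕ → ι → π → Pt d × Finset (Pt d)) :
    ℕ → ι → α → (Fin d → ℕ) := fun K τ c =>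
  cornerCell n L K (levelOf (s K) K ((ped K τ).toPGen (cellP K τ) c).rootStep)
    (rootAnchor ((ped K τ).toPGen (cellP K τ) c))

variable {L : ℕ} {n K₀ : ℕ} {R : ℕ → ℕ → ℕ} {T : ℕ → Finset ι} {ped : ℕ → ι → Pedigree α π}
  {cellP : ℕ → ι → π → Pt d × Finset (Pt d)} {liveC : ℕ → ι → Finset α} {Z : ℕ → ι → α → Finset (Pt d)}

/-- the constant-profile junction: one profile for all runs is `HistoryRealiseCells.RealisedDomains` [folklore] -/
theorem RealisedDomainsR.of_const {sP : ℕ → ℕ} (H : RealisedDomains L sP n K₀ R T ped cellP liveC Z) :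
    RealisedDomainsR L (fun _ => sP) n K₀ R T ped cellP liveC Z :=
  ⟨H.renew_step, H.forest, H.headOldest, H.real, H.track, H.disjoint, H.inBox⟩

/-- … and conversely [folklore] -/
theorem RealisedDomainsR.to_const {sP : ℕ → ℕ} (H : RealisedDomainsR L (fun _ => sP) n K₀ R T ped cellP liveC Z) :
    RealisedDomains L sP n K₀ R T ped cellP liveC Z :=
  ⟨H.renew_step, H.forest, H.headOldest, H.real, H.track, H.disjoint, H.inBox⟩

omit [DecidableEq α] in
/-- the constant-profile root-cell map is `cellOfA` [folklore] -/
theorem cellOfR_const (n L : ℕ) (sP : ℕ → ℕ) (ped : ℕ → ι → Pedigree α π)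
    (cellP : ℕ → ι → π → Pt d × Finset (Pt d)) : cellOfR n L (fun _ => sP) ped cellP = cellOfA n L sP ped cellP := rfl

/-- **FIELD `cell_mem` PER RUN**: the root cell of a live component is a cell of the root's age — for `L, n ≥ 1`,
the run's exponents stepwise non-increasing on `[0, K)` and drop-controlled up to `K`. [folklore] -/
theorem cellOfR_mem_cellN {s : ℕ → ℕ → ℕ} (hL : 0 < L) (hn : 0 < n)
    (H : RealisedDomainsR L s n K₀ R T ped cellP liveC Z) {K : ℕ} (hK : K₀ ≤ K)
    (hs : ∀ t, t < K → s K (t + 1) ≤ s K t) (hdrop : DropCtl (s K) K) {τ : ι} (hτ : τ ∈ T K) {c : α}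
    (hc : c ∈ liveC K τ) : cellOfR n L s ped cellP K τ c ∈ cellN d n L K (K - ((ped K τ).genT c).rootStep) := by
  obtain ⟨hjt, htK⟩ := rootStep_le_of_real (H.real K hK τ hτ c hc)
  have hjK := hjt.trans htK
  rw [← Pedigree.rootStep_toPGen (ped K τ) (cellP K τ) (H.renew_step K hK τ hτ) c]
  exact cornerCell_mem_cellN (mul_pos hn (pow_pos hL K)) (le_levelOf hs _)
    ((levelFn_levelOf hs hdrop).le_K _ hjK) _

/-- **FIELD `cell_inj` PER RUN**: distinct live components of one term have distinct root cells — on ABSOLUTE corners: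
equal corners force NESTED anchor cubes (`coarse_eq_of_cornerCell_eq`, `Qfrom_eq_pow_levelOf_sub_of_le`), both current
domains then contain the re-blocked older anchor (`anchorAt_mem_curDomain`, `track`), contradicting `disjoint`.
[folklore] -/
theorem cellOfR_injOn {s : ℕ → ℕ → ℕ} (hL : 0 < L) (H : RealisedDomainsR L s n K₀ R T ped cellP liveC Z) {K : ℕ}
    (hK : K₀ ≤ K) (hs : ∀ t, t < K → s K (t + 1) ≤ s K t) (hdrop : DropCtl (s K) K) {τ : ι} (hτ : τ ∈ T K) :
    Set.InjOn (cellOfR n L s ped cellP K τ) (liveC K τ : Set α) := by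
  have hLF := levelFn_levelOf hs hdrop
  -- the asymmetric core: an older-rooted `c` and a younger-rooted `c'` with equal corner cells coincide
  have key : ∀ c ∈ liveC K τ, ∀ c' ∈ liveC K τ,
      ((ped K τ).toPGen (cellP K τ) c).rootStep ≤ ((ped K τ).toPGen (cellP K τ) c').rootStep →
      cellOfR n L s ped cellP K τ c = cellOfR n L s ped cellP K τ c' → c = c' := by
    intro c hc c' hc' hjj heq
    by_contra hne
    set P := (ped K τ).toPGen (cellP K τ) c with hP
    set P' := (ped K τ).toPGen (cellP K τ) c' with hP'
    obtain ⟨hjt, htK⟩ := rootStep_le_of_real (H.real K hK τ hτ c hc)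
    obtain ⟨hjt', htK'⟩ := rootStep_le_of_real (H.real K hK τ hτ c' hc')
    have hj'K : P'.rootStep ≤ K := hjt'.trans htK'
    have hnest : coarse (L ^ (levelOf (s K) K P'.rootStep - levelOf (s K) K P.rootStep)) (rootAnchor P) =
        rootAnchor P' :=
      coarse_eq_of_cornerCell_eq hL (H.inBox K hK τ hτ c hc) (H.inBox K hK τ hτ c' hc') (hLF.monotone hjj) heq
    rw [← Qfrom_eq_pow_levelOf_sub_of_le hL hs hdrop hjj hj'K] at hnest
    have hAA : anchorAt L (s K) P K = anchorAt L (s K) P' K := by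
      rw [← coarse_anchorAt L (s K) P hjj hj'K]
      unfold anchorAt
      rw [hnest]
    have hm : anchorAt L (s K) P K ∈ curDomain L (s K) P (Z K τ c) K :=
      anchorAt_mem_curDomain L (s K) (H.track K hK τ hτ c hc) hjt htK
    have hm' : anchorAt L (s K) P' K ∈ curDomain L (s K) P' (Z K τ c') K :=
      anchorAt_mem_curDomain L (s K) (H.track K hK τ hτ c' hc') hjt' htK'
    rw [hAA] at hm
    exact Finset.disjoint_left.1 (H.disjoint K hK τ hτ c hc c' hc' hne) hm hm'
  intro c hc c' hc' heq
  rcases le_total ((ped K τ).toPGen (cellP K τ) c).rootStep ((ped K τ).toPGen (cellP K τ) c').rootStep with h | h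
  · exact key c (Finset.mem_coe.1 hc) c' (Finset.mem_coe.1 hc') h heq
  · exact (key c' (Finset.mem_coe.1 hc') c (Finset.mem_coe.1 hc) h heq.symm).symm

/-- **THE CONSTANT-PROFILE END BINDER, WITHIN-RUN SIDE CONDITIONS**: leaf-03's `RealisedReading` for `cellOfA` from
`RealisedDomains` under drop control and monotonicity PER CUTOFF only (`∀ K ≥ K₀, DropCtl sP K`,
`∀ K ≥ K₀, ∀ t < K, sP (t+1) ≤ sP t`) — the sharp form of `HistoryRealiseCells.realisedReading_of_domains`. [folklore] -/
theorem realisedReading_of_domains_of_le {sP : ℕ → ℕ} (hL : 0 < L) (hn : 0 < n)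
    (hs : ∀ K, K₀ ≤ K → ∀ t, t < K → sP (t + 1) ≤ sP t) (hdrop : ∀ K, K₀ ≤ K → DropCtl sP K)
    (H : RealisedDomains L sP n K₀ R T ped cellP liveC Z) :
    RealisedReading L sP (cellN d n L) K₀ R T ped cellP liveC (cellOfA n L sP ped cellP) where
  renew_step := H.renew_step
  forest := H.forest
  headOldest := H.headOldest
  real K hK τ hτ c hc := ⟨Z K τ c, H.real K hK τ hτ c hc⟩
  cell_mem K hK _ hτ _ hc :=
    cellOfR_mem_cellN hL hn (RealisedDomainsR.of_const H) hK (hs K hK) (hdrop K hK) hτ hc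
  cell_inj K hK _ hτ := cellOfR_injOn hL (RealisedDomainsR.of_const H) hK (hs K hK) (hdrop K hK) hτ

/-! ## §3 (v2) The junction with the per-run reading of `HistoryAssemblyRealiseRun`, and the run's profile -/

/-- **THE JUNCTION** (typer T-NE7b-7; leaf-02 g2's S12d interface, journal l.8332): the displayed per-run reading with
domains gives the per-run `RealisedReadingR` of `HistoryAssemblyRealiseRun` for the DEFINED root-cell map `cellOfR`, the
two cell fields PROVED — under the WITHIN-RUN side conditions `DropCtl (s K) K`, `∀ t < K, s K (t+1) ≤ s K t` per
cutoff `K ≥ K₀` (`L, n ≥ 1`). [folklore] -/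
theorem realisedReadingR_of_domainsR {s : ℕ → ℕ → ℕ} (hL : 0 < L) (hn : 0 < n)
    (hs : ∀ K, K₀ ≤ K → ∀ t, t < K → s K (t + 1) ≤ s K t) (hdrop : ∀ K, K₀ ≤ K → DropCtl (s K) K)
    (H : RealisedDomainsR L s n K₀ R T ped cellP liveC Z) :
    RealisedReadingR L s (cellN d n L) K₀ R T ped cellP liveC (cellOfR n L s ped cellP) where
  renew_step := H.renew_step
  forest := H.forest
  headOldest := H.headOldest
  real K hK τ hτ c hc := ⟨Z K τ c, H.real K hK τ hτ c hc⟩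
  cell_mem K hK _ hτ _ hc := cellOfR_mem_cellN hL hn H hK (hs K hK) (hdrop K hK) hτ hc
  cell_inj K hK _ hτ := cellOfR_injOn hL H hK (hs K hK) (hdrop K hK) hτ

end Reading

/-! ## §4 (v2) At the run's own profile: both side conditions from the flow -/

section Run

variable {F : T4Family} {G : Type*} [GaugeGroup G] [MeasurableSpace G] [HaarData G]

/-- **THE RUN'S PROFILE IS STEPWISE NON-INCREASING, FROM THE FLOW**: along the tuned run at cutoff `K` the couplings
are non-decreasing (the sign `b ≥ 0` of the lower β-bound, `B14FlowStep.g_mono_of_betaNonneg` with the run's RG equation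
`satisfiesRG_of_forwardGenerated` and `betaAlong_of_boxBounds`), hence by (2.5)'s minimality the exponents
`runProfile F.L R K = expOf F.L (R K)` do not increase on `[0, K)` (leaf-07 g2's `HistoryZones.expOf_succ_le`).
[folklore] -/
theorem runProfile_succ_le (D : FiniteEpsData F G) {γ₀ γb b β' β₀ : ℝ} {pe rr : ℕ} (hb : 0 ≤ b)
    (hlo : FlowStep.BetaLowerH b γ₀ D.βfun) (hhi : FlowStep.BetaUpperH β' γ₀ D.βfun) (hγ : γb ≤ γ₀)
    (hγβ : γb ^ 2 * β' < 1) (S : B14FlowStep.SmallnessFor γb β' β₀ F.L pe) {g : ℝ} {g₀ : ℕ → ℝ}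
    (ht : D.Tuned γb g g₀) (R : ℕ → ℕ → ℕ)
    (hR : ∀ K s, s ≤ K → B14.IsRj F.L rr ((D.C ⟨K, F.m, g₀ K⟩).flow.g s) (R K s)) (K : ℕ) :
    ∀ t, t < K → runProfile F.L R K (t + 1) ≤ runProfile F.L R K t := by
  have hI : Step.InInterval γb K (D.C ⟨K, F.m, g₀ K⟩).flow.g := fun k hk => (ht K).1 k hk
  have hrg := satisfiesRG_of_forwardGenerated (C := D.C.toB12) (β := D.βfun) D.curries D.fwd hhi hγ hγβ
    ⟨K, F.m, g₀ K⟩ (ht K).1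
  obtain ⟨hl, -⟩ := betaAlong_of_boxBounds (C := D.C.toB12) (β := D.βfun) D.curries hlo hhi hγ ⟨K, F.m, g₀ K⟩ (ht K).1
  have hpos : ∀ j, j ≤ K → 0 < (D.C ⟨K, F.m, g₀ K⟩).flow.g j := fun j hj => (hI j hj).1
  have hmono : ∀ n, n < K → (D.C ⟨K, F.m, g₀ K⟩).flow.g n ≤ (D.C ⟨K, F.m, g₀ K⟩).flow.g (n + 1) :=
    fun n hn => B14FlowStep.g_mono_of_betaNonneg (D.C ⟨K, F.m, g₀ K⟩).flow K hpos hrg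
      (fun j hj => hb.trans (hl j hj)) (Nat.le_succ n) (by omega)
  have hsucc := expOf_succ_le (two_le_L F) (fun t ht' => hR K t ht') hpos
    (fun n hn => (hI n hn).2.trans S.γ_lt_one.le) hmono
  intro t htK
  show expOf F.L (R K) (min (t + 1) K) ≤ expOf F.L (R K) (min t K)
  rw [min_eq_left (by omega : t + 1 ≤ K), min_eq_left htK.le]
  exact hsucc t htK

variable {ι α π : Type*} [DecidableEq α] {n K₀ : ℕ} {T : ℕ → Finset ι} {ped : ℕ → ι → Pedigree α π}
  {cellP : ℕ → ι → π → Pt d × Finset (Pt d)} {liveC : ℕ → ι → Finset α} {Z : ℕ → ι → α → Finset (Pt d)}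

/-- **THE BRIDGE AT THE RUN'S OWN PROFILE, NO PROFILE SIDE CONDITION DISPLAYED** (typer ACCEPT-A12I v1.3 «typer's
reading of acceptance (count road)»): for the reading realised along `runProfile F.L R` (the exponents of the run's
own sizes, (2.5)), the per-run `RealisedReadingR` with root cells `cellOfR` follows from the displayed `RealisedDomainsR`
ALONE on the geometric side — drop control from leaf-02 g2's `dropCtl_runProfile` (flow side + `β₀ ≤ ½`), monotonicity
from `runProfile_succ_le` (flow side); cells non-degenerate (`0 < n`).  This is the `H` of the R7-b END. [folklore] -/
theorem realisedReadingR_of_domainsRun (D : FiniteEpsData F G) {γ₀ γb b β' β₀ : ℝ} {pe rr : ℕ} (hb : 0 ≤ b)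
    (hlo : FlowStep.BetaLowerH b γ₀ D.βfun) (hhi : FlowStep.BetaUpperH β' γ₀ D.βfun) (hγ : γb ≤ γ₀)
    (hγβ : γb ^ 2 * β' < 1) (S : B14FlowStep.SmallnessFor γb β' β₀ F.L pe) (hrr : rr ≤ pe) (hβ : β₀ ≤ 1 / 2)
    {g : ℝ} {g₀ : ℕ → ℝ} (ht : D.Tuned γb g g₀) (R : ℕ → ℕ → ℕ)
    (hR : ∀ K s, s ≤ K → B14.IsRj F.L rr ((D.C ⟨K, F.m, g₀ K⟩).flow.g s) (R K s)) (hn : 0 < n)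
    (H : RealisedDomainsR F.L (runProfile F.L R) n K₀ R T ped cellP liveC Z) :
    RealisedReadingR F.L (runProfile F.L R) (cellN d n F.L) K₀ R T ped cellP liveC
      (cellOfR n F.L (runProfile F.L R) ped cellP) :=
  realisedReadingR_of_domainsR (lt_of_lt_of_le (by norm_num) (two_le_L F)) hn
    (fun K _ => runProfile_succ_le D hb hlo hhi hγ hγβ S ht R hR K)
    (fun K _ => dropCtl_runProfile D hb hlo hhi hγ hγβ S hrr hβ ht R hR K K) H

end Run

end

end Summit.QuantumFields.BalabanUV.T4Continuum.HistoryRealiseCellsRun
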